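import Mathlib
import Summits.ResolutionOfSingularities.ResolutionOfSingularities.Theorems.TropicalLinksInductiveStepExtIdealPresentation

/-!
# TropicalLinks / InductiveStep — the extended ideal of the unit-graph re-embedding is prime

Route `ResolutionOfSingularities/TropicalLinks`, crux `InductiveStep` (stmt-ResolutionOfSingularities-17233),
line `split`, brick P4a, in support of stub `stub_sncClosureSchon`.

For a field `k`, a prime ideal `I ⊆ R := k[ℤ^N] = AddMonoidAlgebra k (Fin N → ℤ)` and Laurent
polynomials `G₁ … G_m ∈ R` none of which lies in `I`, the route re-embeds the principal open
`U[G⁻¹]` of `U = V(I) ⊆ 𝔾_m^N` into `𝔾_m^(N+m)` by the graph of the units `G_j`; the extended ideal is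
`I' := ⟨ι(I), y_j − ι(G_j)⟩ ⊆ S := k[ℤ^(N+m)]` (inlined route terms, no new definitions).

* `tropicalLinks_extIdeal_isPrime` — **`I'` is prime.**  Proof: by the landed presentation
  `tropicalLinks_extIdeal_presentation`, `S ⧸ I' ≃ₐ[k] (R ⧸ I)[x⁻¹]` with `x = ∏ mk(G_j)`; since `I` is
  prime, `R ⧸ I` is a domain and `x ≠ 0` (no `G_j` lies in `I`), so the localization is a domain, hence
  so is `S ⧸ I'`, i.e. `I'` is prime.

This is the primality hypothesis the valuative criterion `tropicalLinks_isSchonIdeal_of_valuativeCharts`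
needs when the line applies it to `I'` in the final glue of `stub_sncClosureSchon`.
-/

-- single-problem summit: the doubled namespace component `ResolutionOfSingularities` is forced
set_option linter.dupNamespace false

namespace Summit.ResolutionOfSingularities.ResolutionOfSingularities.Theorems

open AddMonoidAlgebra

/-- **The extended ideal of the unit-graph re-embedding is prime.** For a field `k`, a prime ideal
`I ⊆ k[ℤ^N]` and Laurent polynomials `G : Fin m → k[ℤ^N]` with `G j ∉ I` for all `j`, the route's
extended ideal `I' = ⟨ι(I), y_j − ι(G_j)⟩ ⊆ k[ℤ^(N+m)]` (written with the route's inlined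
`ι f = ofCoeff (f.coeff.mapDomain (v ↦ (v,0)))` and `y_j = single (0, e_j) 1`) is prime: its quotient
is `k`-isomorphic to the localization `(k[ℤ^N] ⧸ I)[(∏ G_j)⁻¹]` of a domain at a non-zero element.
[folklore] -/
theorem tropicalLinks_extIdeal_isPrime :
    ∀ (k : Type) [Field k] (N m : ℕ) (I : Ideal (AddMonoidAlgebra k (Fin N → ℤ))) (G : Fin m → AddMonoidAlgebra k (Fin N → ℤ)), I.IsPrime → (∀ j, G j ∉ I) → (Ideal.span ((fun f : AddMonoidAlgebra k (Fin N → ℤ) => (AddMonoidAlgebra.ofCoeff (f.coeff.mapDomain fun v => Fin.append v (0 : Fin m → ℤ)) : AddMonoidAlgebra k (Fin (N + m) → ℤ))) '' (↑I : Set (AddMonoidAlgebra k (Fin N → ℤ))) ∪ Set.range (fun j : Fin m => AddMonoidAlgebra.single (Fin.append (0 : Fin N → ℤ) (Pi.single j (1 : ℤ))) (1 : k) - AddMonoidAlgebra.ofCoeff ((G j).coeff.mapDomain fun v => Fin.append v (0 : Fin m → ℤ))))).IsPrime := by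
  intro k _ N m I G hI hG
  -- the presentation `S ⧸ I' ≃ₐ[k] (R ⧸ I)[x⁻¹]`, `x = mk I (∏ G_j)`
  obtain ⟨e, -, -⟩ := tropicalLinks_extIdeal_presentation k N m I G _ rfl
  -- `R ⧸ I` is a domain and `x ≠ 0`
  haveI : IsDomain (AddMonoidAlgebra k (Fin N → ℤ) ⧸ I) := (Ideal.Quotient.isDomain_iff_prime I).mpr hI
  have hx : Ideal.Quotient.mk I (∏ j, G j) ≠ 0 := by
    rw [Ne, Ideal.Quotient.eq_zero_iff_mem, Ideal.IsPrime.prod_mem_iff]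
    rintro ⟨j, -, hj⟩
    exact hG j hj
  -- hence the localization is a domain, and so is `S ⧸ I'` along `e`
  haveI : IsDomain (Localization.Away (Ideal.Quotient.mk I (∏ j, G j))) :=
    IsLocalization.isDomain_localization (powers_le_nonZeroDivisors_of_noZeroDivisors hx)
  exact (Ideal.Quotient.isDomain_iff_prime _).mp (MulEquiv.isDomain _ e.toMulEquiv)

end Summit.ResolutionOfSingularities.ResolutionOfSingularities.Theorems
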